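import Summits.CriticalPhenomena.PercolationContinuityZ3.Theorems.PercNearOneGluingNoHeavyLowerTailThreePointIsoSexticEdgeNC
import Summits.CriticalPhenomena.PercolationContinuityZ3.Theorems.PercNearOneGluingNoHeavyLowerTailThreePointIsoSexticChord
import HarnessLib

/-!
# `(Q6)_port` on every finite weighted graph — the two induction steps

Support file for crux `stmt-CriticalPhenomena-4575` (`NoHeavyLowerTail`), seat `prim-facecert` gen 20
(`--supports stmt-CriticalPhenomena-4575`; paper proof prim-l12-p1 gen 22, memo
`run/shared/lean/prim/prim-l12/FROM-prim-l12-p1-g22-CHALF-ALL-GRAPHS.md` §8; checked and formalised by prim-facecert gen 20).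
No definitions, no sorries, standard axioms.

Isolation coordinates of three vertices `a, b` and a port `c` of `μ_w = prodBernoulli w` (finite vertex type, arbitrary pair weights):
`Q = P(a|b|c) = μ({a↮b} ∩ {a↮c} ∩ {b↮c})`, `I_a = μ({a↮b} ∩ {a↮c})`, `I_b = μ({a↮b} ∩ {b↮c})`, `I_c = μ({a↮c} ∩ {b↮c})`;
the PORT component of the sextic isolation law is `(Q6)_c : Q⁶ ≤ I_c²·I_b³·I_a³`.  The all-graphs proof is an induction along
the pairs at the port `c`; this file proves the two induction steps for a pair `e` at `c` of weight `p`: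
* `step_terminal` — `e = s(c,a)` (an `E`-move): `Q, I_a, I_c` get multiplied by `1 − p`, `I_b` is unchanged
  (`ThreePointIsoSexticEdgeNC.real_update_eq`, `reachable_insert_iff`), so `(Q6)_c` passes from `w[e↦0]` to `w`;
* `step_main` — `e = s(c,y)`, `y ∉ {a,b,c}`: if `(Q6)_c` holds for `w[e↦0]` and for `w[e↦1]` (the latter with `Q > 0`) then it
  holds for `w`: the four coordinates are affine in the weight of `e`, the decrements are `ΔI_a = μ₀(D_a, a↔y)`,
  `ΔQ = μ₀(S, a↔y) + μ₀(S, b↔y)` (`isoA_diff_insert`, `sep_diff_insert`), the BHK covariance inequality `nc` at `a` and at `b`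
  gives `K_a, K_b ≥ 0`, and `ThreePointIsoSexticChord.sextic_chord_of_cov` (convexity of `Q³/(I_aI_b)^{3/2}`) interpolates.
Also: small facts (`openConn_comm`, lower sets, positivity of events containing `∅` when all weights are `< 1`, an isolated port), and
the induction measure `#(vertices on a positive pair)·(#pairs+1) + #(positive pairs)` (`measure_update_zero_lt`, `measure_fold_lt`).
-/

noncomputable section

namespace Summit.CriticalPhenomena.PercolationContinuityZ3.Theorems.ThreePointIsoSexticAllGraphs

open MeasureTheory Set
open Literature.Probability.Percolation Literature.Probability.Percolation.BHK2006
open Literature.Probability.LatticeModels (prodBernoulli)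
open Summit.CriticalPhenomena.PercolationContinuityZ3.Theorems.ProdWeightPivot
open Summit.CriticalPhenomena.PercolationContinuityZ3.Theorems.ThreePointIsoSexticEdgeNC
open Summit.CriticalPhenomena.PercolationContinuityZ3.Theorems.ThreePointIsoSexticChord
open scoped Classical

variable {V : Type*} [Fintype V]

/-! ## Small facts about the separation events -/

section Events

omit [Fintype V] in
/-- `{a ↮ b} ∩ {a ↮ c}` is a decreasing event. [folklore] -/
theorem isLowerSet_isoA (a b c : V) : IsLowerSet ((openConn a b)ᶜ ∩ (openConn a c)ᶜ : Set (BondConfig V)) :=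
  (isUpperSet_openConn a b).compl.inter (isUpperSet_openConn a c).compl

omit [Fintype V] in
/-- `{a|b|c}` is a decreasing event. [folklore] -/
theorem isLowerSet_sep (a b c : V) :
    IsLowerSet ((openConn a b)ᶜ ∩ (openConn a c)ᶜ ∩ (openConn b c)ᶜ : Set (BondConfig V)) :=
  (isLowerSet_isoA a b c).inter (isUpperSet_openConn b c).compl

omit [Fintype V] in
/-- The empty configuration separates distinct vertices. [folklore] -/
theorem empty_not_mem_openConn {a b : V} (hab : a ≠ b) : (∅ : BondConfig V) ∉ openConn a b := by
  intro h
  change (openGraph (∅ : BondConfig V)).Reachable a b at h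
  have : openGraph (∅ : BondConfig V) = ⊥ := by
    ext x y; simp [openGraph_adj]
  rw [this, SimpleGraph.reachable_bot] at h
  exact hab h

/-- **An isolated vertex is joined to nobody**: if every pair at `c` has weight `0` then `P(a ↔ c) = 0` for `a ≠ c`. [folklore] -/
theorem real_openConn_eq_zero_of_isolated (w : Sym2 V → unitInterval) {a c : V} (hac : a ≠ c)
    (h0 : ∀ y, y ≠ c → (w s(c, y) : ℝ) = 0) : (prodBernoulli w).real (openConn a c) = 0 := by
  rw [real_eq_sum_weight w MeasurableSet.of_discrete]
  refine Finset.sum_eq_zero fun ω _ => ?_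
  by_cases hω : weight (fun e => (w e : ℝ)) ω = 0
  · rw [hω, zero_mul]
  · rw [if_neg, mul_zero]
    intro hr
    obtain ⟨p⟩ := SimpleGraph.Reachable.symm (hr : (openGraph ω).Reachable a c)
    cases p with
    | nil => exact hac rfl
    | cons hadj _ =>
      rw [openGraph_adj] at hadj
      exact hω (Finset.prod_eq_zero (Finset.mem_univ s(c, _)) (by rw [if_pos hadj.1]; exact h0 _ hadj.2.symm))

end Events

/-! ## The induction measure: live vertices and positive pairs -/

section Measure

/-- Closing a positive pair lowers the measure `#live·(K+1) + #positive pairs`. [this work] -/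
theorem measure_update_zero_lt (w : Sym2 V → unitInterval) {e : Sym2 V} (he : 0 < (w e : ℝ)) :
    (Finset.univ.filter fun y : V => ∃ f : Sym2 V, y ∈ f ∧ 0 < ((Function.update w e 0 f : unitInterval) : ℝ)).card *
        (Fintype.card (Sym2 V) + 1) +
      (Finset.univ.filter fun f : Sym2 V => 0 < ((Function.update w e 0 f : unitInterval) : ℝ)).card <
    (Finset.univ.filter fun y : V => ∃ f : Sym2 V, y ∈ f ∧ 0 < (w f : ℝ)).card * (Fintype.card (Sym2 V) + 1) +
      (Finset.univ.filter fun f : Sym2 V => 0 < (w f : ℝ)).card := by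
  have hval : ∀ f, ((Function.update w e 0 f : unitInterval) : ℝ) = if f = e then 0 else (w f : ℝ) := by
    intro f; by_cases h : f = e
    · subst h; simp
    · simp [h]
  have hL : (Finset.univ.filter fun y : V => ∃ f : Sym2 V, y ∈ f ∧ 0 < ((Function.update w e 0 f : unitInterval) : ℝ)) ⊆
      (Finset.univ.filter fun y : V => ∃ f : Sym2 V, y ∈ f ∧ 0 < (w f : ℝ)) := by
    intro y hy
    simp only [Finset.mem_filter, Finset.mem_univ, true_and] at hy ⊢
    obtain ⟨f, hyf, hf⟩ := hy
    rw [hval] at hf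
    by_cases h : f = e
    · rw [if_pos h] at hf; exact absurd hf (lt_irrefl 0)
    · rw [if_neg h] at hf; exact ⟨f, hyf, hf⟩
  have hP : (Finset.univ.filter fun f : Sym2 V => 0 < ((Function.update w e 0 f : unitInterval) : ℝ)) ⊂
      (Finset.univ.filter fun f : Sym2 V => 0 < (w f : ℝ)) := by
    rw [Finset.ssubset_iff_of_subset]
    · refine ⟨e, Finset.mem_filter.2 ⟨Finset.mem_univ _, he⟩, by simp⟩
    · intro f hf
      simp only [Finset.mem_filter, Finset.mem_univ, true_and] at hf ⊢
      rw [hval] at hf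
      by_cases h : f = e
      · rw [if_pos h] at hf; exact absurd hf (lt_irrefl 0)
      · rw [if_neg h] at hf; exact hf
  have h1 := Finset.card_le_card hL
  have h2 := Finset.card_lt_card hP
  nlinarith

/-- A fold lowers the measure: the live vertices lose `y`, the positive pairs are at most all pairs. [this work] -/
theorem measure_fold_lt {w w' : Sym2 V → unitInterval} {y : V} (hy : ∃ f : Sym2 V, y ∈ f ∧ 0 < (w f : ℝ))
    (hlive : ∀ z, (∃ f : Sym2 V, z ∈ f ∧ 0 < (w' f : ℝ)) → z ≠ y ∧ ∃ f : Sym2 V, z ∈ f ∧ 0 < (w f : ℝ)) :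
    (Finset.univ.filter fun z : V => ∃ f : Sym2 V, z ∈ f ∧ 0 < (w' f : ℝ)).card * (Fintype.card (Sym2 V) + 1) +
        (Finset.univ.filter fun f : Sym2 V => 0 < (w' f : ℝ)).card <
      (Finset.univ.filter fun z : V => ∃ f : Sym2 V, z ∈ f ∧ 0 < (w f : ℝ)).card * (Fintype.card (Sym2 V) + 1) +
        (Finset.univ.filter fun f : Sym2 V => 0 < (w f : ℝ)).card := by
  set L' := Finset.univ.filter fun z : V => ∃ f : Sym2 V, z ∈ f ∧ 0 < (w' f : ℝ) with hL'
  set L := Finset.univ.filter fun z : V => ∃ f : Sym2 V, z ∈ f ∧ 0 < (w f : ℝ) with hL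
  have hsub : L' ⊆ L.erase y := by
    intro z hz
    simp only [hL', Finset.mem_filter, Finset.mem_univ, true_and] at hz
    obtain ⟨hzy, hz'⟩ := hlive z hz
    exact Finset.mem_erase.2 ⟨hzy, by simpa [hL] using hz'⟩
  have hyL : y ∈ L := by simpa [hL] using hy
  have h1 : L'.card ≤ L.card - 1 := by
    have := Finset.card_le_card hsub; rwa [Finset.card_erase_of_mem hyL] at this
  have h2 : 1 ≤ L.card := Finset.card_pos.2 ⟨y, hyL⟩
  have h3 : (Finset.univ.filter fun f : Sym2 V => 0 < (w' f : ℝ)).card ≤ Fintype.card (Sym2 V) :=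
    Finset.card_le_univ _
  have h4 : L'.card + 1 ≤ L.card := by omega
  nlinarith

end Measure

/-! ## The two induction steps -/

section Steps

omit [Fintype V] in
/-- Symmetry `a ↔ b` of the port component of `(Q6)`. [folklore] -/
theorem q6_swap (μ : Measure (BondConfig V)) {a b c : V}
    (h : μ.real ((openConn b a)ᶜ ∩ (openConn b c)ᶜ ∩ (openConn a c)ᶜ) ^ 6 ≤
      μ.real ((openConn b c)ᶜ ∩ (openConn a c)ᶜ) ^ 2 * μ.real ((openConn b a)ᶜ ∩ (openConn a c)ᶜ) ^ 3 *
        μ.real ((openConn b a)ᶜ ∩ (openConn b c)ᶜ) ^ 3) :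
    μ.real ((openConn a b)ᶜ ∩ (openConn a c)ᶜ ∩ (openConn b c)ᶜ) ^ 6 ≤
      μ.real ((openConn a c)ᶜ ∩ (openConn b c)ᶜ) ^ 2 * μ.real ((openConn a b)ᶜ ∩ (openConn b c)ᶜ) ^ 3 *
        μ.real ((openConn a b)ᶜ ∩ (openConn a c)ᶜ) ^ 3 := by
  have openConn_comm : ∀ a b : V, (openConn b a : Set (BondConfig V)) = openConn a b := fun a b =>
    Set.ext fun ω => ⟨fun h => SimpleGraph.Reachable.symm h, fun h => SimpleGraph.Reachable.symm h⟩
  rw [openConn_comm a b] at h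
  have e1 : ((openConn a b)ᶜ ∩ (openConn b c)ᶜ ∩ (openConn a c)ᶜ : Set (BondConfig V)) =
      (openConn a b)ᶜ ∩ (openConn a c)ᶜ ∩ (openConn b c)ᶜ := by ext ω; simp only [mem_inter_iff]; tauto
  have e2 : ((openConn b c)ᶜ ∩ (openConn a c)ᶜ : Set (BondConfig V)) = (openConn a c)ᶜ ∩ (openConn b c)ᶜ := inter_comm _ _
  rw [e1, e2] at h
  linarith

/-- **The terminal-pair step** (`e = s(c,a)`, an `E`-move): adding to `G ∖ e` a pair between the port `c` and the terminal `a` of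
weight `p` multiplies `Q, I_a, I_c` by `1 − p` and fixes `I_b`, so the port component of `(Q6)` passes from `G ∖ e` to `G`. [this work] -/
theorem step_terminal (w : Sym2 V → unitInterval) {a b c : V} (hac : a ≠ c)
    (h0 : (prodBernoulli (Function.update w s(c, a) 0)).real ((openConn a b)ᶜ ∩ (openConn a c)ᶜ ∩ (openConn b c)ᶜ) ^ 6 ≤
      (prodBernoulli (Function.update w s(c, a) 0)).real ((openConn a c)ᶜ ∩ (openConn b c)ᶜ) ^ 2 *
        (prodBernoulli (Function.update w s(c, a) 0)).real ((openConn a b)ᶜ ∩ (openConn b c)ᶜ) ^ 3 *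
          (prodBernoulli (Function.update w s(c, a) 0)).real ((openConn a b)ᶜ ∩ (openConn a c)ᶜ) ^ 3) :
    (prodBernoulli w).real ((openConn a b)ᶜ ∩ (openConn a c)ᶜ ∩ (openConn b c)ᶜ) ^ 6 ≤
      (prodBernoulli w).real ((openConn a c)ᶜ ∩ (openConn b c)ᶜ) ^ 2 *
        (prodBernoulli w).real ((openConn a b)ᶜ ∩ (openConn b c)ᶜ) ^ 3 *
          (prodBernoulli w).real ((openConn a b)ᶜ ∩ (openConn a c)ᶜ) ^ 3 := by
  set e := s(c, a) with he
  set μ₀ := prodBernoulli (Function.update w e 0) with hμ₀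
  set p : ℝ := (w e : ℝ) with hp
  have hp0 : 0 ≤ p := (w e).2.1
  have hp1 : p ≤ 1 := (w e).2.2
  have hw : Function.update w e (w e) = w := Function.update_eq_self e w
  -- weight-`1` reading and affinity in the weight of `e`, derived from `real_update_eq`
  have r1 : ∀ A : Set (BondConfig V), (prodBernoulli (Function.update w e 1)).real A =
      (prodBernoulli (Function.update w e 0)).real {ω | insert e ω ∈ A} := fun A => by
    have h := ThreePointIsoSexticEdgeNC.real_update_eq w e 1 A
    simp only [Set.Icc.coe_one, sub_self, zero_mul, zero_add, one_mul] at h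
    exact h
  have aff : ∀ A : Set (BondConfig V), (prodBernoulli w).real A =
      (1 - (w e : ℝ)) * (prodBernoulli (Function.update w e 0)).real A +
        (w e : ℝ) * (prodBernoulli (Function.update w e 1)).real A := fun A => by
    have h := ThreePointIsoSexticEdgeNC.real_update_eq w e (w e) A
    rw [hw] at h
    rw [h, r1]
  -- the configuration with `e` added always joins `a` to `c`
  have hac' : ∀ ω : BondConfig V, insert e ω ∈ (openConn a c : Set (BondConfig V)) := fun ω =>
    SimpleGraph.Adj.reachable ((openGraph_adj _ a c).2 ⟨by rw [he, Sym2.eq_swap]; exact mem_insert _ _, hac⟩)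
  have hS1 : (prodBernoulli (Function.update w e 1)).real ((openConn a b)ᶜ ∩ (openConn a c)ᶜ ∩ (openConn b c)ᶜ) = 0 := by
    rw [r1]
    have : {ω : BondConfig V | insert e ω ∈ ((openConn a b)ᶜ ∩ (openConn a c)ᶜ ∩ (openConn b c)ᶜ : Set (BondConfig V))} = ∅ :=
      Set.eq_empty_of_forall_notMem fun ω hω => hω.1.2 (hac' ω)
    rw [this, measureReal_empty]
  have hA1 : (prodBernoulli (Function.update w e 1)).real ((openConn a b)ᶜ ∩ (openConn a c)ᶜ) = 0 := by
    rw [r1]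
    have : {ω : BondConfig V | insert e ω ∈ ((openConn a b)ᶜ ∩ (openConn a c)ᶜ : Set (BondConfig V))} = ∅ :=
      Set.eq_empty_of_forall_notMem fun ω hω => hω.2 (hac' ω)
    rw [this, measureReal_empty]
  have hC1 : (prodBernoulli (Function.update w e 1)).real ((openConn a c)ᶜ ∩ (openConn b c)ᶜ) = 0 := by
    rw [r1]
    have : {ω : BondConfig V | insert e ω ∈ ((openConn a c)ᶜ ∩ (openConn b c)ᶜ : Set (BondConfig V))} = ∅ :=
      Set.eq_empty_of_forall_notMem fun ω hω => hω.1 (hac' ω)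
    rw [this, measureReal_empty]
  have hB1 : (prodBernoulli (Function.update w e 1)).real ((openConn a b)ᶜ ∩ (openConn b c)ᶜ) =
      μ₀.real ((openConn a b)ᶜ ∩ (openConn b c)ᶜ) := by
    rw [r1, hμ₀]
    congr 1; ext ω
    have moc : ∀ {ω : BondConfig V} {p q : V}, ω ∈ openConn p q ↔ (openGraph ω).Reachable p q := Iff.rfl
    simp only [mem_setOf_eq, mem_inter_iff, mem_compl_iff, moc, he, reachable_insert_iff]
    constructor
    · rintro ⟨h1, h2⟩
      exact ⟨fun h => h1 (Or.inl h), fun h => h2 (Or.inl h)⟩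
    · rintro ⟨h1, h2⟩
      refine ⟨?_, ?_⟩
      · rintro (h | ⟨-, h⟩ | ⟨-, h⟩) <;> [exact h1 h; exact h1 h; exact h2 h.symm]
      · rintro (h | ⟨h, -⟩ | ⟨h, -⟩) <;> [exact h2 h; exact h2 h; exact h1 h.symm]
  -- affinity in the weight of `e`
  have aS := aff ((openConn a b)ᶜ ∩ (openConn a c)ᶜ ∩ (openConn b c)ᶜ)
  have aA := aff ((openConn a b)ᶜ ∩ (openConn a c)ᶜ)
  have aB := aff ((openConn a b)ᶜ ∩ (openConn b c)ᶜ)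
  have aC := aff ((openConn a c)ᶜ ∩ (openConn b c)ᶜ)
  rw [hS1] at aS; rw [hA1] at aA; rw [hB1] at aB; rw [hC1] at aC
  rw [aS, aA, aB, aC, ← hμ₀, ← hp]
  simp only [mul_zero, add_zero]
  have hB' : (1 - p) * μ₀.real ((openConn a b)ᶜ ∩ (openConn b c)ᶜ) + p * μ₀.real ((openConn a b)ᶜ ∩ (openConn b c)ᶜ) =
      μ₀.real ((openConn a b)ᶜ ∩ (openConn b c)ᶜ) := by ring
  rw [hB']
  set Q₀ := μ₀.real ((openConn a b)ᶜ ∩ (openConn a c)ᶜ ∩ (openConn b c)ᶜ)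
  set A₀ := μ₀.real ((openConn a b)ᶜ ∩ (openConn a c)ᶜ)
  set B₀ := μ₀.real ((openConn a b)ᶜ ∩ (openConn b c)ᶜ)
  set C₀ := μ₀.real ((openConn a c)ᶜ ∩ (openConn b c)ᶜ)
  have hR : 0 ≤ C₀ ^ 2 * B₀ ^ 3 * A₀ ^ 3 := by positivity
  have h5 : (1 - p) ^ 6 ≤ (1 - p) ^ 5 := pow_le_pow_of_le_one (sub_nonneg.2 hp1) (by linarith) (by norm_num)
  calc ((1 - p) * Q₀) ^ 6 = (1 - p) ^ 6 * Q₀ ^ 6 := by ring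
    _ ≤ (1 - p) ^ 6 * (C₀ ^ 2 * B₀ ^ 3 * A₀ ^ 3) := mul_le_mul_of_nonneg_left h0 (pow_nonneg (sub_nonneg.2 hp1) 6)
    _ ≤ (1 - p) ^ 5 * (C₀ ^ 2 * B₀ ^ 3 * A₀ ^ 3) := mul_le_mul_of_nonneg_right h5 hR
    _ = ((1 - p) * C₀) ^ 2 * B₀ ^ 3 * ((1 - p) * A₀) ^ 3 := by ring

/-- **The main step** (`e = s(c,y)`, `y ∉ {a,b,c}`): if the port component of `(Q6)` holds for `w[e↦0]` and `w[e↦1]`, the latter with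
`P_{w[e↦1]}(a|b|c) > 0`, then it holds for `w`.  Ingredients: affinity in the weight of `e`, the decrements as probabilities of
`{a ↔ y}`/`{b ↔ y}` inside the isolation events, the covariance inequality `nc` at `a` and at `b`, and the convex-chord lemma
`sextic_chord_of_cov`. [this work] -/
theorem step_main (w : Sym2 V → unitInterval) {a b c y : V} (hab : a ≠ b) (hac : a ≠ c) (hbc : b ≠ c)
    (hya : y ≠ a) (hyb : y ≠ b)
    (h0 : (prodBernoulli (Function.update w s(c, y) 0)).real ((openConn a b)ᶜ ∩ (openConn a c)ᶜ ∩ (openConn b c)ᶜ) ^ 6 ≤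
      (prodBernoulli (Function.update w s(c, y) 0)).real ((openConn a c)ᶜ ∩ (openConn b c)ᶜ) ^ 2 *
        (prodBernoulli (Function.update w s(c, y) 0)).real ((openConn a b)ᶜ ∩ (openConn b c)ᶜ) ^ 3 *
          (prodBernoulli (Function.update w s(c, y) 0)).real ((openConn a b)ᶜ ∩ (openConn a c)ᶜ) ^ 3)
    (h1 : (prodBernoulli (Function.update w s(c, y) 1)).real ((openConn a b)ᶜ ∩ (openConn a c)ᶜ ∩ (openConn b c)ᶜ) ^ 6 ≤
      (prodBernoulli (Function.update w s(c, y) 1)).real ((openConn a c)ᶜ ∩ (openConn b c)ᶜ) ^ 2 *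
        (prodBernoulli (Function.update w s(c, y) 1)).real ((openConn a b)ᶜ ∩ (openConn b c)ᶜ) ^ 3 *
          (prodBernoulli (Function.update w s(c, y) 1)).real ((openConn a b)ᶜ ∩ (openConn a c)ᶜ) ^ 3)
    (hpos : 0 < (prodBernoulli (Function.update w s(c, y) 1)).real ((openConn a b)ᶜ ∩ (openConn a c)ᶜ ∩ (openConn b c)ᶜ)) :
    (prodBernoulli w).real ((openConn a b)ᶜ ∩ (openConn a c)ᶜ ∩ (openConn b c)ᶜ) ^ 6 ≤
      (prodBernoulli w).real ((openConn a c)ᶜ ∩ (openConn b c)ᶜ) ^ 2 *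
        (prodBernoulli w).real ((openConn a b)ᶜ ∩ (openConn b c)ᶜ) ^ 3 *
          (prodBernoulli w).real ((openConn a b)ᶜ ∩ (openConn a c)ᶜ) ^ 3 := by
  have moc : ∀ {ω : BondConfig V} {p q : V}, ω ∈ openConn p q ↔ (openGraph ω).Reachable p q := Iff.rfl
  have openConn_comm : ∀ a b : V, (openConn b a : Set (BondConfig V)) = openConn a b := fun a b =>
    Set.ext fun ω => ⟨fun h => SimpleGraph.Reachable.symm h, fun h => SimpleGraph.Reachable.symm h⟩
  have hp0 : 0 ≤ (w s(c, y) : ℝ) := (w s(c, y)).2.1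
  have hp1 : (w s(c, y) : ℝ) ≤ 1 := (w s(c, y)).2.2
  have hw : Function.update w s(c, y) (w s(c, y)) = w := Function.update_eq_self _ w
  -- weight-`1` reading and affinity in the weight of the pair, derived from `real_update_eq`
  have r1 : ∀ A : Set (BondConfig V), (prodBernoulli (Function.update w s(c, y) 1)).real A =
      (prodBernoulli (Function.update w s(c, y) 0)).real {ω | insert s(c, y) ω ∈ A} := fun A => by
    have h := ThreePointIsoSexticEdgeNC.real_update_eq w s(c, y) 1 A
    simp only [Set.Icc.coe_one, sub_self, zero_mul, zero_add, one_mul] at h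
    exact h
  have aff : ∀ A : Set (BondConfig V), (prodBernoulli w).real A =
      (1 - (w s(c, y) : ℝ)) * (prodBernoulli (Function.update w s(c, y) 0)).real A +
        (w s(c, y) : ℝ) * (prodBernoulli (Function.update w s(c, y) 1)).real A := fun A => by
    have h := ThreePointIsoSexticEdgeNC.real_update_eq w s(c, y) (w s(c, y)) A
    rw [hw] at h
    rw [h, r1]
  -- decrements as probabilities of `{a ↔ y}` / `{b ↔ y}` under `w[e↦0]`
  have dS : (prodBernoulli (Function.update w s(c, y) 0)).real ((openConn a b)ᶜ ∩ (openConn a c)ᶜ ∩ (openConn b c)ᶜ) -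
      (prodBernoulli (Function.update w s(c, y) 1)).real ((openConn a b)ᶜ ∩ (openConn a c)ᶜ ∩ (openConn b c)ᶜ) =
      (prodBernoulli (Function.update w s(c, y) 0)).real ((openConn a b)ᶜ ∩ (openConn a c)ᶜ ∩ (openConn b c)ᶜ ∩ openConn a y) +
      (prodBernoulli (Function.update w s(c, y) 0)).real ((openConn a b)ᶜ ∩ (openConn a c)ᶜ ∩ (openConn b c)ᶜ ∩ openConn b y) := by
    rw [real_update_zero_sub_one w s(c, y) (isLowerSet_sep a b c), sep_diff_insert a b c y, inter_union_distrib_left]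
    refine measureReal_union ?_ MeasurableSet.of_discrete
    rw [Set.disjoint_left]
    rintro ω ⟨⟨⟨hab', -⟩, -⟩, hay⟩ ⟨-, hby⟩
    exact hab' ((moc.1 hay).trans (moc.1 hby).symm)
  have dA : (prodBernoulli (Function.update w s(c, y) 0)).real ((openConn a b)ᶜ ∩ (openConn a c)ᶜ) -
      (prodBernoulli (Function.update w s(c, y) 1)).real ((openConn a b)ᶜ ∩ (openConn a c)ᶜ) =
      (prodBernoulli (Function.update w s(c, y) 0)).real ((openConn a b)ᶜ ∩ (openConn a c)ᶜ ∩ openConn a y) := by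
    rw [real_update_zero_sub_one w s(c, y) (isLowerSet_isoA a b c), isoA_diff_insert a b c y]
  have dB : (prodBernoulli (Function.update w s(c, y) 0)).real ((openConn a b)ᶜ ∩ (openConn b c)ᶜ) -
      (prodBernoulli (Function.update w s(c, y) 1)).real ((openConn a b)ᶜ ∩ (openConn b c)ᶜ) =
      (prodBernoulli (Function.update w s(c, y) 0)).real ((openConn a b)ᶜ ∩ (openConn b c)ᶜ ∩ openConn b y) := by
    have hl : IsLowerSet ((openConn a b)ᶜ ∩ (openConn b c)ᶜ : Set (BondConfig V)) :=
      (isUpperSet_openConn a b).compl.inter (isUpperSet_openConn b c).compl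
    rw [real_update_zero_sub_one w s(c, y) hl]
    have h := isoA_diff_insert b a c y (V := V)
    rw [openConn_comm a b] at h
    rw [h]
  -- the two covariance inequalities (BHK) under `w[e↦0]`
  have hKa := nc (Function.update w s(c, y) 0) (a := a) (b := b) (c := c) (x := y) hya hab.symm hac.symm
  have hKb := nc (Function.update w s(c, y) 0) (a := b) (b := a) (c := c) (x := y) hyb hab hbc.symm
  rw [openConn_comm a b] at hKb
  have e1 : ((openConn a b)ᶜ ∩ (openConn b c)ᶜ ∩ (openConn a c)ᶜ : Set (BondConfig V)) =
      (openConn a b)ᶜ ∩ (openConn a c)ᶜ ∩ (openConn b c)ᶜ := by ext ω; simp only [mem_inter_iff]; tauto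
  have e2 : ((openConn a b)ᶜ ∩ (openConn b c)ᶜ ∩ openConn b y ∩ (openConn a c)ᶜ : Set (BondConfig V)) =
      (openConn a b)ᶜ ∩ (openConn a c)ᶜ ∩ (openConn b c)ᶜ ∩ openConn b y := by ext ω; simp only [mem_inter_iff]; tauto
  have e3 : ((openConn a b)ᶜ ∩ (openConn a c)ᶜ ∩ openConn a y ∩ (openConn b c)ᶜ : Set (BondConfig V)) =
      (openConn a b)ᶜ ∩ (openConn a c)ᶜ ∩ (openConn b c)ᶜ ∩ openConn a y := by ext ω; simp only [mem_inter_iff]; tauto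
  rw [e1, e2] at hKb
  rw [e3] at hKa
  -- order facts
  have hQ1A1 : (prodBernoulli (Function.update w s(c, y) 1)).real ((openConn a b)ᶜ ∩ (openConn a c)ᶜ ∩ (openConn b c)ᶜ) ≤
      (prodBernoulli (Function.update w s(c, y) 1)).real ((openConn a b)ᶜ ∩ (openConn a c)ᶜ) :=
    measureReal_mono inter_subset_left
  have hQ1B1 : (prodBernoulli (Function.update w s(c, y) 1)).real ((openConn a b)ᶜ ∩ (openConn a c)ᶜ ∩ (openConn b c)ᶜ) ≤
      (prodBernoulli (Function.update w s(c, y) 1)).real ((openConn a b)ᶜ ∩ (openConn b c)ᶜ) :=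
    measureReal_mono (by rintro ω ⟨⟨h1, -⟩, h3⟩; exact ⟨h1, h3⟩)
  -- affinity in the weight of `e`
  have aS := aff ((openConn a b)ᶜ ∩ (openConn a c)ᶜ ∩ (openConn b c)ᶜ)
  have aA := aff ((openConn a b)ᶜ ∩ (openConn a c)ᶜ)
  have aB := aff ((openConn a b)ᶜ ∩ (openConn b c)ᶜ)
  have aC := aff ((openConn a c)ᶜ ∩ (openConn b c)ᶜ)
  rw [aS, aA, aB, aC]
  -- name the numbers and apply the chord lemma
  set p : ℝ := (w s(c, y) : ℝ)
  set Q₀ := (prodBernoulli (Function.update w s(c, y) 0)).real ((openConn a b)ᶜ ∩ (openConn a c)ᶜ ∩ (openConn b c)ᶜ)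
  set Q₁ := (prodBernoulli (Function.update w s(c, y) 1)).real ((openConn a b)ᶜ ∩ (openConn a c)ᶜ ∩ (openConn b c)ᶜ)
  set A₀ := (prodBernoulli (Function.update w s(c, y) 0)).real ((openConn a b)ᶜ ∩ (openConn a c)ᶜ)
  set A₁ := (prodBernoulli (Function.update w s(c, y) 1)).real ((openConn a b)ᶜ ∩ (openConn a c)ᶜ)
  set B₀ := (prodBernoulli (Function.update w s(c, y) 0)).real ((openConn a b)ᶜ ∩ (openConn b c)ᶜ)
  set B₁ := (prodBernoulli (Function.update w s(c, y) 1)).real ((openConn a b)ᶜ ∩ (openConn b c)ᶜ)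
  set C₀ := (prodBernoulli (Function.update w s(c, y) 0)).real ((openConn a c)ᶜ ∩ (openConn b c)ᶜ)
  set C₁ := (prodBernoulli (Function.update w s(c, y) 1)).real ((openConn a c)ᶜ ∩ (openConn b c)ᶜ)
  set dQa := (prodBernoulli (Function.update w s(c, y) 0)).real ((openConn a b)ᶜ ∩ (openConn a c)ᶜ ∩ (openConn b c)ᶜ ∩ openConn a y)
  set dQb := (prodBernoulli (Function.update w s(c, y) 0)).real ((openConn a b)ᶜ ∩ (openConn a c)ᶜ ∩ (openConn b c)ᶜ ∩ openConn b y)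
  set dA' := (prodBernoulli (Function.update w s(c, y) 0)).real ((openConn a b)ᶜ ∩ (openConn a c)ᶜ ∩ openConn a y)
  set dB' := (prodBernoulli (Function.update w s(c, y) 0)).real ((openConn a b)ᶜ ∩ (openConn b c)ᶜ ∩ openConn b y)
  have hA : A₁ ≤ A₀ := by linarith [dA, (measureReal_nonneg : 0 ≤ dA')]
  have hB : B₁ ≤ B₀ := by linarith [dB, (measureReal_nonneg : 0 ≤ dB')]
  have hKa' : (A₀ - A₁) * Q₀ ≤ dQa * A₀ := by rw [dA]; linarith [hKa]
  have hKb' : (B₀ - B₁) * Q₀ ≤ dQb * B₀ := by rw [dB]; linarith [hKb]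
  have key := sextic_chord_of_cov (Q₀ := Q₀) (Q₁ := Q₁) (A₀ := A₀) (A₁ := A₁) (B₀ := B₀) (B₁ := B₁) (C₀ := C₀) (C₁ := C₁)
    (dQa := dQa) (dQb := dQb) (r := p)
    hpos (lt_of_lt_of_le hpos hQ1A1) hA (lt_of_lt_of_le hpos hQ1B1) hB measureReal_nonneg measureReal_nonneg
    measureReal_nonneg measureReal_nonneg dS hKa' hKb' (by linarith [h0]) (by linarith [h1]) hp0 hp1
  linarith [key]

end Steps

end Summit.CriticalPhenomena.PercolationContinuityZ3.Theorems.ThreePointIsoSexticAllGraphs
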